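import Mathlib
import HarnessLib
import Literature.MathematicalPhysics.StatisticalMechanics.RenormalisationStepLocality
import Literature.MathematicalPhysics.StatisticalMechanics.GradientFieldNormsTwoScale
import Literature.MathematicalPhysics.QuantumFieldTheory.TphiSeminormFluctuationContraction

/-!
# Lemma 10.3 of [ABKM19]: the single-block term `G(B) = (1 − Π₂) R_{k+1} K(B)` measured at the next
# scale, `|G(B)|_{k+1,B,T_φ} ≤ (1 + |φ|_{k+1,B})⁵ c_G w_{k:k+1}^B(φ) ‖R_{k+1}K(B)‖_{k:k+1,B}`

The pointwise heart of the contraction for single blocks ([ABKM19] (10.10)–(10.12)): for a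
`C^{r₀}` functional `F` (in the source `F = R_{k+1}K(B)`), local for the scale-`k` gauge
`T = fieldGauge 𝔥 R p S` of the box `S ⊇ B` and bounded by a weight,
`|F|_{T_ψ} ≤ C_F w(ψ)` for all `ψ` (`w ≥ 1`, `w(0) = 1`, `w` `T`-local and monotone along rays —
e.g. `w = w_{k:k+1}^B`), the remainder `Pi2Rem a B F = F − Π₂F(B)` satisfies in the NEXT-scale
gauge `T' = fieldGauge 𝔥' R' p S`

`|Pi2Rem F|_{T'_φ} ≤ C_F · c_G · (1 + ‖T'φ‖)⁵ · w(φ)`,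
`c_G = (1 + C_{8.7}) (ε_{8.9} + 2ρ³)`, `ρ = (𝔥'/𝔥)(R/R')`

(`ε_{8.9} = pi2ContrFactor`, `C_{8.7} = pi2BoundConst`; with the [ABKM19] parameters
`ε_{8.9} = O(L^{−d'})`, `2ρ³ = 16L^{−3d/2}`).  Ingredients: the two-norm estimate with a
REGULATOR (`tayNorm_two_gauge_le_of_regulator`, gauge form of
`TphiSeminormFluctuationContraction.tphiSeminorm_le_of_tzero_of_regulator` — the source's
`sup_{t∈[0,1]} |·|_{k,B,T_{tφ}}`), Lemma 8.9 at `T'_0` (`tayNorm_Pi2Rem_le`), the polynomial bound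
`|Π₂F(B)|_{T_ψ} ≤ (1+‖Tψ‖)² ‖Π₂F‖_{k,0}` (`tayNorm_eval_le`) and Lemma 8.7 (`hamNorm_Pi2_le`).
The factor `(1+‖T'φ‖)⁵ w_{k:k+1}` is then absorbed by (w9) (Lemma 10.4) — not in this file.

Everything here is proved; no named fact.

## References
* S. Adams, S. Buchholz, R. Kotecký, S. Müller, arXiv:1910.13564, Lemma 10.3 ((10.10)–(10.12)),
  Lemma 8.1 (8.3), Lemmas 8.7, 8.9 [AdamsBuchholzKoteckyMuller2019].
* R. Bauerschmidt, D. Brydges, G. Slade, LNM 2242 (2019), Corollary 7.5.4 [BauerschmidtBrydgesSlade2019RG].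
-/

noncomputable section

namespace Literature.MathematicalPhysics.StatisticalMechanics.GradientRG

open Finset
open Literature.MathematicalPhysics.QuantumFieldTheory

/-! ## The two-norm estimate with a regulator (gauge form) -/

section TwoNorm

variable {E V : Type*} [NormedAddCommGroup E] [NormedSpace ℝ E] [FiniteDimensional ℝ E]
  [NormedAddCommGroup V] [NormedSpace ℝ V]
  {𝔸 : Type*} [NormedRing 𝔸] [NormedAlgebra ℝ 𝔸] [CompleteSpace 𝔸]

/-- **Two-norm estimate with a regulator** ([ABKM19] Prop. 13.11 / Lemma 8.1 (8.3) in the form used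
in Lemma 10.3): let `‖T₁ ξ‖ ≤ ρ ‖T₂ ξ‖` (`0 < ρ ≤ 1`), `F` `T₁`-local and `C^{r₀}`, `m < r₀`, and let
`G` be a `T₂`-local regulator, monotone along rays, with `‖F‖^{(T₁)}_{T_ψ} ≤ A_reg G(ψ)` for all
`ψ`.  Then `‖F‖^{(T₂)}_{T_φ} ≤ (1 + ‖T₂φ‖)^{m+1} (‖F‖^{(T₂)}_{T_0} + 2ρ^{m+1} A_reg G(φ))`.
[cite: AdamsBuchholzKoteckyMuller2019, Proposition 13.11] -/
theorem tayNorm_two_gauge_le_of_regulator {V₁ : Type*} [NormedAddCommGroup V₁] [NormedSpace ℝ V₁]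
    (T₁ : E →ₗ[ℝ] V₁) (T₂ : E →ₗ[ℝ] V) {ρ : ℝ} (hρ0 : 0 < ρ) (hρ1 : ρ ≤ 1)
    (h : ∀ ξ, ‖T₁ ξ‖ ≤ ρ * ‖T₂ ξ‖) {r₀ m : ℕ} (hm : m < r₀) {F : E → 𝔸} (hF : ContDiff ℝ r₀ F)
    (hloc : IsGaugeLocal T₁ F) {G : E → ℝ} (hGloc : IsGaugeLocal T₂ G)
    (hGray : ∀ ψ : E, ∀ t ∈ Set.Icc (0 : ℝ) 1, G (t • ψ) ≤ G ψ) {Areg : ℝ} (hA : 0 ≤ Areg)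
    (hFA : ∀ ψ : E, tayNorm T₁ r₀ F ψ ≤ Areg * G ψ) (φ : E) :
    tayNorm T₂ r₀ F φ ≤
      (1 + ‖T₂ φ‖) ^ (m + 1) * (tayNorm T₂ r₀ F 0 + 2 * ρ ^ (m + 1) * (Areg * G φ)) := by
  -- the regulator on the gauge space `range T₂`
  set G₂ : LinearMap.range T₂ → ℝ := fun w => G (gaugeSection T₂ w) with hG₂
  have hsup : ∀ w : LinearMap.range T₂, tphiSeminorm r₀ ρ⁻¹ (gaugeLift T₂ F) w ≤ Areg * G₂ w := by
    intro w
    have hw : T₂.rangeRestrict (gaugeSection T₂ w) = w := rangeRestrict_gaugeSection T₂ w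
    calc tphiSeminorm r₀ ρ⁻¹ (gaugeLift T₂ F) w
        = tphiSeminorm r₀ ρ⁻¹ (gaugeLift T₂ F) (T₂.rangeRestrict (gaugeSection T₂ w)) := by rw [hw]
      _ ≤ tphiSeminorm r₀ (ρ⁻¹ * ρ) (gaugeLift T₁ F) (T₁.rangeRestrict (gaugeSection T₂ w)) :=
          tphiSeminorm_gaugeLift_mono_gauge T₁ T₂ hρ0.le h hF hloc (inv_nonneg.2 hρ0.le) _
      _ = tayNorm T₁ r₀ F (gaugeSection T₂ w) := by
          rw [inv_mul_cancel₀ hρ0.ne', ← tayNorm_eq_tphiSeminorm]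
      _ ≤ Areg * G₂ w := hFA _
  have hG₂ray : ∀ w : LinearMap.range T₂, ∀ t ∈ Set.Icc (0 : ℝ) 1, G₂ (t • w) ≤ G₂ w := by
    intro w t ht
    show G (gaugeSection T₂ (t • w)) ≤ G (gaugeSection T₂ w)
    rw [map_smul]
    exact hGray _ t ht
  have key := tphiSeminorm_le_of_tzero_of_regulator r₀ hm one_pos (one_le_inv_iff₀.2 ⟨hρ0, hρ1⟩)
    (contDiff_gaugeLift T₂ hF) hG₂ray hA hsup (T₂.rangeRestrict φ)
  have hGφ : G₂ (T₂.rangeRestrict φ) = G φ :=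
    hGloc _ _ (by rw [apply_gaugeSection]; rfl)
  rw [tayNorm_eq_tphiSeminorm, tayNorm_eq_tphiSeminorm, map_zero]
  rw [div_one, one_div, inv_inv, hGφ] at key
  exact key

end TwoNorm

/-! ## Lemma 10.3 -/

section SingleBlock

variable {𝕜 : Type*} [NormedField 𝕜] [NormedAlgebra ℝ 𝕜] [CompleteSpace 𝕜] {d M : ℕ} [NeZero M]

/-- The single-block contraction constant `c_G = (1 + C_{8.7})(ε_{8.9} + 2ρ³)`, `ρ = (𝔥'/𝔥)(R/R')`
([ABKM19] (10.10): `C_1 L^{-d'} + 8(C_2+1)L^{-3d/2}` up to bookkeeping).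
[cite: AdamsBuchholzKoteckyMuller2019, Lemma 10.3 (10.10)] -/
def blockContrConst (d : ℕ) (𝔥 𝔥' R R' L κ C₁ C₀ : ℝ) : ℝ :=
  (1 + pi2BoundConst d C₀) * (pi2ContrFactor d 𝔥 𝔥' R R' L κ C₁ + 2 * (𝔥' / 𝔥 * (R / R')) ^ 3)

/-- `C_{8.7} ≥ 0` for `C₀ ≥ 0`. [cite: AdamsBuchholzKoteckyMuller2019, Lemma 8.7] -/
theorem pi2BoundConst_nonneg (d : ℕ) {C₀ : ℝ} (hC₀ : 0 ≤ C₀) : 0 ≤ pi2BoundConst d C₀ := by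
  unfold pi2BoundConst
  have := pi2GeoSum_nonneg d
  positivity

variable {a : Fin d → ZMod M} {B S : Finset (Fin d → ZMod M)} {p r₀ ρ' : ℕ}
  {𝔥 𝔥' R R' L κ C₁ : ℝ} {K : ((Fin d → ZMod M) → ℝ) → 𝕜}

/-- **Lemma 10.3 (pointwise single-block contraction).**  In the setting of Lemma 8.9 (box
`S = a + [0,ρ']^d ⊇ B` with room for the test polynomials, scales `R' = LR`, `𝔥' ≤ κ𝔥`, `𝔥' ≤ 𝔥`,
`ρ = (𝔥'/𝔥)(R/R') ≤ 1`, `r₀ ≥ 3`), let `F` be `C^{r₀}` and `T`-local with `|F|_{T_ψ} ≤ C_F w(ψ)` for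
a `T`-local weight `w ≥ 1`, `w(0) = 1`, monotone along rays.  Then for every `φ`
`|F − Π₂F(B)|_{T'_φ} ≤ C_F c_G (1 + ‖T'φ‖)⁵ w(φ)`.
[cite: AdamsBuchholzKoteckyMuller2019, Lemma 10.3] -/
theorem tayNorm_Pi2Rem_le_weighted (hS : ∀ x, x ∈ S ↔ InBox a ρ' x) (ha : InBox a ρ' a)
    (hroom : ∀ x ∈ S, HasRoom a x p) (hp : d / 2 + 2 ≤ p) (hBS : B ⊆ S) (hB : B.card ≠ 0)
    {C₀ : ℝ} (h𝔥 : 0 < 𝔥) (h𝔥' : 0 < 𝔥') (hR : 0 < R) (hL : 1 ≤ L) (hRR : R' = L * R)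
    (hκ : 𝔥' ≤ κ * 𝔥) (h𝔥'le : 𝔥' ≤ 𝔥) (hC₁ : 0 ≤ C₁) (hρ : (ρ' : ℝ) ≤ C₁ * R) (hC₀ : 1 ≤ C₀)
    (hρ0 : (ρ' : ℝ) + (d / 2 + 1 : ℕ) ≤ C₀ * R) (hθ : 𝔥' / 𝔥 * (R / R') ≤ 1) (hr₀ : 3 ≤ r₀)
    (hK : ContDiff ℝ r₀ K) (hloc : IsGaugeLocal (fieldGauge 𝔥 R p S) K)
    {w : ((Fin d → ZMod M) → ℝ) → ℝ} (hw1 : ∀ ψ, 1 ≤ w ψ) (hw0 : w 0 = 1)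
    (hwloc : IsGaugeLocal (fieldGauge 𝔥 R p S) w)
    (hwray : ∀ ψ : (Fin d → ZMod M) → ℝ, ∀ t ∈ Set.Icc (0 : ℝ) 1, w (t • ψ) ≤ w ψ)
    {CF : ℝ} (hCF : 0 ≤ CF) (hKw : ∀ ψ, tayNorm (fieldGauge 𝔥 R p S) r₀ K ψ ≤ CF * w ψ)
    (φ : (Fin d → ZMod M) → ℝ) :
    tayNorm (fieldGauge 𝔥' R' p S) r₀ (Pi2Rem a B K) φ ≤
      CF * blockContrConst d 𝔥 𝔥' R R' L κ C₁ C₀ * (1 + ‖fieldGauge 𝔥' R' p S φ‖) ^ 5 * w φ := by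
  set T := fieldGauge 𝔥 R p S with hT
  set T' := fieldGauge 𝔥' R' p S with hT'
  set C₂ := pi2BoundConst d C₀ with hC₂
  set ε := pi2ContrFactor d 𝔥 𝔥' R R' L κ C₁ with hε
  set ρ : ℝ := 𝔥' / 𝔥 * (R / R') with hρdef
  have hR' : 0 < R' := by rw [hRR]; nlinarith
  have hRR' : R ≤ R' := by rw [hRR]; nlinarith
  have hρpos : 0 < ρ := by positivity
  have hp' : d / 2 + 1 ≤ p := by omega
  have hr₀2 : 2 ≤ r₀ := by omega
  have hC₂0 : 0 ≤ C₂ := pi2BoundConst_nonneg d (by linarith)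
  have hκ0 : 0 ≤ κ := by nlinarith
  have hL0 : 0 < L := by linarith
  have hε0 : 0 ≤ ε := by simp only [hε, pi2ContrFactor]; positivity
  -- the relevant part `E = Π₂F(B)` and its bounds
  set Epart : ((Fin d → ZMod M) → ℝ) → 𝕜 := fun φ => eval (Pi2 a B K) B φ with hE
  have hEd : ContDiff ℝ r₀ Epart := contDiff_eval _ _
  have hSρ : ∀ x ∈ S, ∀ i, |relCoord a x i| ≤ ρ' := fun x hx i => by
    obtain ⟨h1, h2⟩ := (hS x).1 hx i
    rw [abs_of_nonneg h1]; exact h2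
  have hK0 : tayNorm T r₀ K 0 ≤ CF := by have := hKw 0; rwa [hw0, mul_one] at this
  have hham : hamNorm 𝔥 R B.card (Pi2 a B K) ≤ C₂ * CF :=
    (hamNorm_Pi2_le hB hBS hroom hSρ h𝔥 hR hC₀ hρ0 hr₀2 hK hloc).trans
      (mul_le_mul_of_nonneg_left hK0 hC₂0)
  -- Step A: the regulator bound at scale `k`: `|Pi2Rem F|_{T_ψ} ≤ C_F(1+C₂)(1+‖Tψ‖)² w(ψ)`
  have hA : ∀ ψ, tayNorm T r₀ (Pi2Rem a B K) ψ ≤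
      CF * (1 + C₂) * ((1 + ‖T ψ‖) ^ 2 * w ψ) := by
    intro ψ
    have hdec : Pi2Rem a B K = K + (-1 : ℝ) • Epart := by
      rw [Pi2Rem, neg_one_smul, sub_eq_add_neg]
    have h1 : tayNorm T r₀ (Pi2Rem a B K) ψ ≤ tayNorm T r₀ K ψ + tayNorm T r₀ Epart ψ := by
      have hG : ContDiff ℝ r₀ ((-1 : ℝ) • Epart) := hEd.const_smul (-1 : ℝ)
      have h1' := tayNorm_add_le T hK hG ψ
      rw [tayNorm_smul T hEd, abs_neg, abs_one, one_mul] at h1'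
      rw [hdec]; exact h1'
    have h2 : tayNorm T r₀ Epart ψ ≤ (1 + ‖T ψ‖) ^ 2 * (C₂ * CF) :=
      (tayNorm_eval_le h𝔥 hR hp' hBS (Pi2 a B K) r₀ ψ).trans
        (mul_le_mul_of_nonneg_left hham (by positivity))
    have h3 := hKw ψ
    have hw := hw1 ψ
    have ht : (1 : ℝ) ≤ (1 + ‖T ψ‖) ^ 2 := one_le_pow₀ (by linarith [norm_nonneg (T ψ)])
    have h4 : CF * w ψ ≤ CF * ((1 + ‖T ψ‖) ^ 2 * w ψ) :=
      mul_le_mul_of_nonneg_left (le_mul_of_one_le_left (by linarith) ht) hCF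
    have h5 : (1 + ‖T ψ‖) ^ 2 * (C₂ * CF) ≤ CF * C₂ * ((1 + ‖T ψ‖) ^ 2 * w ψ) := by
      have : (1 + ‖T ψ‖) ^ 2 * (C₂ * CF) * 1 ≤ (1 + ‖T ψ‖) ^ 2 * (C₂ * CF) * w ψ :=
        mul_le_mul_of_nonneg_left hw (by positivity)
      linarith
    calc tayNorm T r₀ (Pi2Rem a B K) ψ ≤ CF * w ψ + (1 + ‖T ψ‖) ^ 2 * (C₂ * CF) := by linarith
      _ ≤ CF * (1 + C₂) * ((1 + ‖T ψ‖) ^ 2 * w ψ) := by linarith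
  -- Step B: the two-norm estimate with regulator `(1+‖Tψ‖)² w(ψ)`
  have hregloc : IsGaugeLocal T' fun ψ => (1 + ‖T ψ‖) ^ 2 * w ψ := by
    have h1 : IsGaugeLocal T fun ψ => (1 + ‖T ψ‖) ^ 2 * w ψ :=
      IsGaugeLocal.op₂ T (fun x y : ℝ => (1 + x) ^ 2 * y) (fun _ _ h => by simp only [h]) hwloc
    exact (isGaugeLocal_fieldGauge_iff h𝔥.ne' hR.ne' h𝔥'.ne' hR'.ne').1 h1
  have hregray : ∀ ψ : (Fin d → ZMod M) → ℝ, ∀ t ∈ Set.Icc (0 : ℝ) 1,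
      (1 + ‖T (t • ψ)‖) ^ 2 * w (t • ψ) ≤ (1 + ‖T ψ‖) ^ 2 * w ψ := by
    intro ψ t ht
    have ht1 : ‖T (t • ψ)‖ ≤ ‖T ψ‖ := by
      rw [map_smul, norm_smul, Real.norm_eq_abs, abs_of_nonneg ht.1]
      exact mul_le_of_le_one_left (norm_nonneg _) ht.2
    have hw0' : 0 ≤ w (t • ψ) := by linarith [hw1 (t • ψ)]
    calc (1 + ‖T (t • ψ)‖) ^ 2 * w (t • ψ) ≤ (1 + ‖T ψ‖) ^ 2 * w (t • ψ) := by gcongr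
      _ ≤ (1 + ‖T ψ‖) ^ 2 * w ψ := mul_le_mul_of_nonneg_left (hwray ψ t ht) (by positivity)
  have hB2 := tayNorm_two_gauge_le_of_regulator T T' hρpos hθ
    (fun ξ => norm_fieldGauge_le_mul h𝔥 h𝔥' hR hRR' p S ξ) (m := 2) (by omega)
    (contDiff_Pi2Rem hK) (isGaugeLocal_Pi2Rem h𝔥.ne' hR.ne' hp' hBS hloc) hregloc hregray
    (by positivity : (0 : ℝ) ≤ CF * (1 + C₂)) hA φ
  -- Step C: Lemma 8.9 at `T'_0`
  have hC : tayNorm T' r₀ (Pi2Rem a B K) 0 ≤ ε * (1 + C₂) * CF :=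
    (tayNorm_Pi2Rem_le hS ha hroom hp hBS hB h𝔥 h𝔥' hR hL hRR hκ hC₁ hρ hC₀ hρ0 hθ hr₀2 hK hloc).trans
      (mul_le_mul_of_nonneg_left hK0 (by positivity))
  -- Step D: assemble, using `‖Tφ‖ ≤ ‖T'φ‖` and `1 ≤ (1+‖T'φ‖)² w(φ)`
  have htt : ‖T φ‖ ≤ ‖T' φ‖ := norm_fieldGauge_mono_weights h𝔥' h𝔥'le hR hRR' p S φ
  set t' := ‖T' φ‖ with ht'
  have ht'0 : 0 ≤ t' := norm_nonneg _
  have hwφ := hw1 φ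
  have hsq : (1 + ‖T φ‖) ^ 2 ≤ (1 + t') ^ 2 := by
    have : 0 ≤ 1 + ‖T φ‖ := by linarith [norm_nonneg (T φ)]
    gcongr
  have h1t : (1 : ℝ) ≤ (1 + t') ^ 2 * w φ := by
    have : (1 : ℝ) ≤ (1 + t') ^ 2 := one_le_pow₀ (by linarith)
    nlinarith
  calc tayNorm T' r₀ (Pi2Rem a B K) φ
      ≤ (1 + t') ^ 3 * (tayNorm T' r₀ (Pi2Rem a B K) 0 +
          2 * ρ ^ 3 * (CF * (1 + C₂) * ((1 + ‖T φ‖) ^ 2 * w φ))) := hB2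
    _ ≤ (1 + t') ^ 3 * (ε * (1 + C₂) * CF * ((1 + t') ^ 2 * w φ) +
          2 * ρ ^ 3 * (CF * (1 + C₂) * ((1 + t') ^ 2 * w φ))) := by
        have hw0' : 0 ≤ w φ := by linarith
        gcongr
        calc tayNorm T' r₀ (Pi2Rem a B K) 0 ≤ ε * (1 + C₂) * CF := hC
          _ = ε * (1 + C₂) * CF * 1 := (mul_one _).symm
          _ ≤ ε * (1 + C₂) * CF * ((1 + t') ^ 2 * w φ) :=
              mul_le_mul_of_nonneg_left h1t (by positivity)
    _ = CF * blockContrConst d 𝔥 𝔥' R R' L κ C₁ C₀ * (1 + t') ^ 5 * w φ := by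
        rw [blockContrConst, ← hC₂, ← hε, ← hρdef]; ring

end SingleBlock

end Literature.MathematicalPhysics.StatisticalMechanics.GradientRG

end
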